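import Summits.HodgeConjecture.HodgeConjecture.Theorems.K2LiuDoublingHeightDecayPointwise   -- ★ #16a (K2Liu-p04): `vecHeight_one_entries_le_plucker`, the height of record
import HarnessLib

/-!
# Crux `HLiu418`, Track B road `K2_Liu`, organ (B∞) «ARCHIMEDEAN SLICE» of #32dR — brick B4′:
# SHARP archimedean decay of a `P_Δ`-height along the doubling embedding, `Φ(ι(g,1)) ≤ C · H_∞(g)^{-1}`

Cell `hodgecm-mathlib`, crux item hLiu418 = `stmt-HodgeConjecture-24832`, route of record `HCCMUnconditional`; squad K2 ∕ K2Liu,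
prover K2Liu-p02 (g3); LEAD deal 03:15:05Z (organ (B∞) `K2LiuDoublingHeightArchSlice`, the `_harch` hypothesis of ★ p856795
`doublingHeightDecayLocal_of_slices` at `N = 2`).  THEOREMS ONLY; lane `--supports stmt-HodgeConjecture-24832 --as helper`.

THE POINT.  ★ #16a (`K2LiuDoublingHeightDecayPointwise`) proves `Φ(ι(g,1)) ≤ C ‖g‖^{-1∕4}`; the exponent `1∕4` comes from the generic
transfer `h(1,g,g⁻¹) ≤ C₂ h(1,g)²` (★ F5) and is too weak for the archimedean slice of #32dR, whose integrability threshold `τ > 2N − 2`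
is attained only by the SHARP exponent.  Here the exponent is `1` in the ARCHIMEDEAN height `H_∞ = GLn.archHeight`:

* §1 `‖ι(z)‖ ≤ R` on the mixed space from `‖z_w‖ ≤ R` at every place (sup norm, componentwise isometries); for a TOTALLY COMPLEX field and a
  vector `x` with a coordinate `1`, `|x_i|_w² ≤ h(x)` (every archimedean local height is the SQUARE of the Euclidean norm, `mult w = 2`).
* §2 for `g ∈ U(diag d)(𝔸)` over a CM field: `(g⁻¹)ᵢₖ = dᵢ⁻¹ σ(g_{kᵢ}) d_k` (★ F5 `coe_inv_apply`) and `|σ(a)|_w = |a|_{σ⁻¹ w}`, so EVERY entry of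
  `g_∞` and `g_∞⁻¹` is bounded by `C_d · max_{w,kl} |g_{kl}|_w`, whence **`H_∞(g)² ≤ C · h(1,(g_{ij}))`**.
* §3 with ★ #16a §3 `h(1,(g_{ij})) ≤ C₁ h(π(ι(g,1)))`: the Plücker height of record `Φ₀ = h(π(·))^{-1∕2}` satisfies
  **`Φ₀(ι(g,1)) ≤ C · H_∞(g)^{-1}`**; §4 any continuous positive `Φ` of type `(P_Δ, modDelta)` is `≤ C' Φ₀` (★ p854882 over ★ (I)).

Sharpness (for the record): along the `U(1,1)` boost `a_s` one has `Φ₀(ι(a_s,1)) ≍ (cosh s)^{-1} ≍ H_∞(a_s)^{-1}`.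
[cite: GelbartPiatetskishapiroRallis1987, Part A §2] [cite: Liu2021, Lem. B.10 (2) p. 102] [cite: BorelJacquet1979, §1.2]

HONEST LABEL.  `HC_CM` is proved only modulo the 7 printed citations (2 remaining named inputs: hLiu418 = `stmt-HodgeConjecture-24832`, h413 =
`stmt-HodgeConjecture-24833`) until rung 0 closes; this file is a brick of organ (B∞) and retires nothing by itself.
-/

set_option autoImplicit false
-- the mandated namespace repeats the single-problem summit's segment (`HodgeConjecture.HodgeConjecture`)
set_option linter.dupNamespace false

noncomputable section

open scoped Matrix NNReal Kronecker Classical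
open NumberField NumberField.mixedEmbedding IsDedekindDomain

namespace Summit.HodgeConjecture.HodgeConjecture.Cruxes.HLiu418.K2LiuDoublingHeightArchDecay

open Literature.NumberTheory.Automorphic Literature.NumberTheory.Automorphic.UnitaryGroup
open Literature.NumberTheory.GelbartRogawski1991 Literature.NumberTheory.GelbartRogawski1991.GRConstruction
open Literature.NumberTheory.K2Lit.SiegelDoubled
open Literature.LinearAlgebra.Matrix
open Summit.HodgeConjecture.HodgeConjecture.Cruxes.HLiu418.K2LiuSiegelDoubledPluckerFrame
open Summit.HodgeConjecture.HodgeConjecture.Cruxes.HLiu418.K2LiuSiegelDoubledPluckerHeight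
open Summit.HodgeConjecture.HodgeConjecture.Cruxes.HLiu418.K2LiuSiegelDeltaHeightExists
open Summit.HodgeConjecture.HodgeConjecture.Cruxes.HLiu418.K2LiuDoublingPluckerCoordinates
open Summit.HodgeConjecture.HodgeConjecture.Cruxes.HLiu418.K2LiuUnitaryInverseHeight
open Summit.HodgeConjecture.HodgeConjecture.Cruxes.HLiu418.K2LiuAdelicHeightGLVsVecHeight
open Summit.HodgeConjecture.HodgeConjecture.Cruxes.HLiu418.K2LiuDoublingHeightDecayPointwise

/-! ## §1 Sup norms on the mixed space; squares of coordinates under a totally complex height -/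

section Generic

variable {K : Type} [Field K] [NumberField K]

open NumberField.InfinitePlace.Completion in
/-- `‖ι(z)‖ ≤ R` for the mixed-space image `ι(z)` of `z ∈ K_∞` as soon as `‖z_w‖ ≤ R` at every infinite place
(`ι = InfiniteAdeleRing.ringEquiv_mixedSpace K` is componentwise isometric and the mixed space carries the sup norm; the argument of
★ F3 `nnnorm_ringEquiv_mixedSpace_fst_le_of_apply_eq_one` for an arbitrary bound). [cite: Garrett2018, §2.2 (PDF p. 81)] -/
theorem nnnorm_ringEquiv_mixedSpace_le {z : InfiniteAdeleRing K} {R : ℝ≥0} (h : ∀ w : InfinitePlace K, ‖z w‖₊ ≤ R) :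
    ‖InfiniteAdeleRing.ringEquiv_mixedSpace K z‖₊ ≤ R := by
  rw [← NNReal.coe_le_coe, coe_nnnorm]
  have hR : (0 : ℝ) ≤ (R : ℝ) := NNReal.coe_nonneg _
  have h' : ∀ w : InfinitePlace K, ‖z w‖ ≤ (R : ℝ) := fun w => by
    rw [← coe_nnnorm, NNReal.coe_le_coe]; exact h w
  refine max_le ?_ ?_
  · refine (pi_norm_le_iff_of_nonneg hR).2 fun w => ?_
    have e : ‖z w.1‖ = ‖(InfiniteAdeleRing.ringEquiv_mixedSpace K z).1 w‖ := by
      rw [InfiniteAdeleRing.ringEquiv_mixedSpace_apply]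
      exact ((AddMonoidHomClass.isometry_iff_norm _).1 (isometry_extensionEmbeddingOfIsReal w.2) _).symm
    rw [← e]; exact h' w.1
  · refine (pi_norm_le_iff_of_nonneg hR).2 fun w => ?_
    have e : ‖z w.1‖ = ‖(InfiniteAdeleRing.ringEquiv_mixedSpace K z).2 w‖ := by
      rw [InfiniteAdeleRing.ringEquiv_mixedSpace_apply]
      exact ((AddMonoidHomClass.isometry_iff_norm _).1 (isometry_extensionEmbedding w.1) _).symm
    rw [← e]; exact h' w.1

variable {ι : Type*} [Fintype ι]

/-- If `x i₀ = 1`, the archimedean part `∏_w ‖x‖_w^{mult w}` of the height is at most the height (every finite local height is `≥ 1`).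
[cite: Garrett2018, §2.2 (PDF p. 81)] -/
theorem prod_vecArchNorm_pow_le_vecHeight {x : ι → AdeleRing (𝓞 K) K} (i₀ : ι) (h1 : x i₀ = 1) :
    ∏ w : InfinitePlace K, vecArchNorm K w x ^ w.mult ≤ vecHeight K x := by
  rw [vecHeight]
  exact le_mul_of_one_le_right' (one_le_finprod' fun v => one_le_vecFinHeight_of_apply_eq_one i₀ h1 v)

/-- **`|x_i|_w² ≤ h(x)`** for a vector with a coordinate `1` over a TOTALLY COMPLEX field: the local height at the (complex) place `w` is the
square `‖x‖_w²` of the Euclidean norm (`mult w = 2`), and all other local factors are `≥ 1`. [cite: Garrett2018, §2.2 (PDF p. 81)] -/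
theorem nnnorm_fst_sq_le_vecHeight [IsTotallyComplex K] {x : ι → AdeleRing (𝓞 K) K} (i₀ : ι) (h1 : x i₀ = 1) (i : ι)
    (w : InfinitePlace K) : ‖(x i).1 w‖₊ ^ 2 ≤ vecHeight K x :=
  calc ‖(x i).1 w‖₊ ^ 2 ≤ vecArchNorm K w x ^ 2 := pow_le_pow_left₀ zero_le (nnnorm_fst_apply_le_vecArchNorm w x i) 2
    _ = vecArchNorm K w x ^ w.mult := by rw [IsTotallyComplex.mult_eq]
    _ ≤ ∏ w' : InfinitePlace K, vecArchNorm K w' x ^ w'.mult :=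
        Finset.single_le_prod' (f := fun w' : InfinitePlace K => vecArchNorm K w' x ^ w'.mult)
          (fun w' _ => one_le_pow_of_one_le' (one_le_vecArchNorm_of_apply_eq_one i₀ h1 w') _) (Finset.mem_univ w)
    _ ≤ vecHeight K x := prod_vecArchNorm_pow_le_vecHeight i₀ h1

/-- **`H_∞(g) ≤ R`** as soon as every archimedean component of every entry of `g` and of `g⁻¹` has absolute value `≤ R`: the entries of
`g_∞`, `g_∞⁻¹` are the mixed-space images `ι((g_{ij})_∞)`, `ι(((g⁻¹)_{ij})_∞)` (★ `GLn.coe_toMixed_apply`, ★ F3 `toMixed_inv_coe_apply`).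
[cite: BorelJacquet1979, §1.2] -/
theorem archHeight_le_of_forall_nnnorm_le {n : ℕ} (g : GL (Fin n) (AdeleRing (𝓞 K) K)) {R : ℝ≥0}
    (h : ∀ (i j : Fin n) (w : InfinitePlace K), ‖(((g : Matrix (Fin n) (Fin n) (AdeleRing (𝓞 K) K)) i j).1 w)‖₊ ≤ R)
    (h' : ∀ (i j : Fin n) (w : InfinitePlace K),
      ‖((((g⁻¹ : GL (Fin n) (AdeleRing (𝓞 K) K)) : Matrix (Fin n) (Fin n) (AdeleRing (𝓞 K) K)) i j).1 w)‖₊ ≤ R) :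
    GLn.archHeight n K g ≤ R := by
  unfold GLn.archHeight
  refine Finset.sup_le fun ij _ => sup_le ?_ ?_
  · have e : ((GLn.toMixed n K g : GL (Fin n) (mixedSpace K)) : Matrix (Fin n) (Fin n) (mixedSpace K)) ij.1 ij.2 =
        InfiniteAdeleRing.ringEquiv_mixedSpace K (((g : Matrix (Fin n) (Fin n) (AdeleRing (𝓞 K) K)) ij.1 ij.2).1) := rfl
    rw [e]
    exact nnnorm_ringEquiv_mixedSpace_le (h ij.1 ij.2)
  · rw [toMixed_inv_coe_apply]
    exact nnnorm_ringEquiv_mixedSpace_le (h' ij.1 ij.2)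

end Generic

/-! ## §2 Unitary matrices over a CM field: `H_∞(g)² ≤ C · h(1, (g_{ij}))` -/

section Unitary

variable (L : Type) [Field L] [NumberField L] [IsCMField L] {N : ℕ} (dV : Fin N → L)

/-- `|σ(a)|_w = |a|_{σ⁻¹ w}` for the conjugation `σ = c ⊗ 1` of `𝔸_L` at an infinite place. [cite: CasselsFrohlichANT1967, Ch. VII §1.1] -/
theorem nnnorm_smul_fst_apply (a : AdeleRing (𝓞 L) L) (w : InfinitePlace L) :
    ‖(IsCMField.complexConj L • a).1 w‖₊ = ‖a.1 ((IsCMField.complexConj L)⁻¹ • w)‖₊ := by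
  have h := InfiniteAdeleRing.norm_smul_apply_smul (Fp L) (IsCMField.complexConj L) a.1 ((IsCMField.complexConj L)⁻¹ • w)
  rw [smul_inv_smul] at h
  rw [← NNReal.coe_inj, coe_nnnorm, coe_nnnorm]
  exact h

/-- **Entries of `g⁻¹` at the infinite places, `g ∈ U(diag d)(𝔸)`**: `|(g⁻¹)ᵢₖ|_w = |dᵢ⁻¹|_w |d_k|_w |g_{kᵢ}|_{σ⁻¹ w}`, from
`(g⁻¹)ᵢₖ = dᵢ⁻¹ σ(g_{kᵢ}) d_k` (★ F5 `coe_inv_apply`). [cite: Rogawski1990, §1.9 p. 8] -/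
theorem nnnorm_inv_entry_fst_apply (hdV0 : ∀ i, dV i ≠ 0)
    (g : UnitaryGroup.adelic (Fp L) L (IsCMField.complexConj L) N (Matrix.diagonal dV)) (i k : Fin N) (w : InfinitePlace L) :
    ‖((((g : GL (Fin N) (AdeleRing (𝓞 L) L))⁻¹ : GL (Fin N) (AdeleRing (𝓞 L) L)) : Matrix (Fin N) (Fin N) (AdeleRing (𝓞 L) L)) i k).1 w‖₊ =
      ‖(algebraMap L (AdeleRing (𝓞 L) L) (dV i)⁻¹).1 w‖₊ * ‖(algebraMap L (AdeleRing (𝓞 L) L) (dV k)).1 w‖₊ *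
        ‖((((g : GL (Fin N) (AdeleRing (𝓞 L) L)) : Matrix (Fin N) (Fin N) (AdeleRing (𝓞 L) L)) k i).1
          ((IsCMField.complexConj L)⁻¹ • w))‖₊ := by
  have e2 := coe_inv_apply L dV hdV0 g i k
  rw [Subgroup.coe_inv] at e2
  rw [e2, AdeleRing.mul_fst_apply, AdeleRing.mul_fst_apply, nnnorm_mul, nnnorm_mul, nnnorm_smul_fst_apply, mul_right_comm]

/-- **`H_∞(g)² ≤ C · h(1, (g_{ij}))` on `U(diag d)(𝔸)`** over a CM field.  Every entry of `g_∞` is `ι((g_{ij})_∞)`, every entry of `g_∞⁻¹` is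
`ι(((g⁻¹)_{ik})_∞)` with `|(g⁻¹)ᵢₖ|_w = |dᵢ⁻¹|_w |d_k|_w |g_{kᵢ}|_{σ⁻¹ w}`, so all of them have absolute value `≤ (1 ⊔ C_d) · max_{w,kl} |g_{kl}|_w`
(`C_d = max |dᵢ⁻¹|_w |d_k|_w`), and `max_{w,kl} |g_{kl}|_w² ≤ h(1,(g_{ij}))` since `L` is totally complex (§1).
[cite: BorelJacquet1979, §1.2] [cite: Rogawski1990, §1.9 p. 8] -/
theorem exists_archHeight_sq_le_vecHeight_one_entries (hdV0 : ∀ i, dV i ≠ 0) :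
    ∃ C : ℝ≥0, ∀ g : UnitaryGroup.adelic (Fp L) L (IsCMField.complexConj L) N (Matrix.diagonal dV),
      GLn.archHeight N L (g : GL (Fin N) (AdeleRing (𝓞 L) L)) ^ 2 ≤
        C * vecHeight L (fun o : Option (Fin N × Fin N) => o.elim 1 fun ij =>
          ((g : GL (Fin N) (AdeleRing (𝓞 L) L)) : Matrix (Fin N) (Fin N) (AdeleRing (𝓞 L) L)) ij.1 ij.2) := by
  classical
  set Cd : ℝ≥0 := Finset.univ.sup fun p : (Fin N × Fin N) × InfinitePlace L =>
    ‖(algebraMap L (AdeleRing (𝓞 L) L) (dV p.1.1)⁻¹).1 p.2‖₊ * ‖(algebraMap L (AdeleRing (𝓞 L) L) (dV p.1.2)).1 p.2‖₊ with hCd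
  have hCd1 : ∀ (i k : Fin N) (w : InfinitePlace L),
      ‖(algebraMap L (AdeleRing (𝓞 L) L) (dV i)⁻¹).1 w‖₊ * ‖(algebraMap L (AdeleRing (𝓞 L) L) (dV k)).1 w‖₊ ≤ max 1 Cd := fun i k w => by
    refine le_trans ?_ (le_max_right _ _)
    rw [hCd]
    -- (`have`, then `exact`: elaborating `Finset.le_sup` against the goal makes the unifier project a metavariable pair)
    have h := Finset.le_sup (f := fun p : (Fin N × Fin N) × InfinitePlace L =>
      ‖(algebraMap L (AdeleRing (𝓞 L) L) (dV p.1.1)⁻¹).1 p.2‖₊ * ‖(algebraMap L (AdeleRing (𝓞 L) L) (dV p.1.2)).1 p.2‖₊)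
        (Finset.mem_univ ((i, k), w))
    exact h
  refine ⟨max 1 Cd ^ 2, fun g => ?_⟩
  -- `M = max_{w,kl} |g_{kl}|_w`
  obtain ⟨M, hM⟩ : ∃ M : ℝ≥0, M = Finset.univ.sup fun p : (Fin N × Fin N) × InfinitePlace L =>
      ‖((((g : GL (Fin N) (AdeleRing (𝓞 L) L)) : Matrix (Fin N) (Fin N) (AdeleRing (𝓞 L) L)) p.1.1 p.1.2).1 p.2)‖₊ := ⟨_, rfl⟩
  have hentry : ∀ (i j : Fin N) (w : InfinitePlace L),
      ‖((((g : GL (Fin N) (AdeleRing (𝓞 L) L)) : Matrix (Fin N) (Fin N) (AdeleRing (𝓞 L) L)) i j).1 w)‖₊ ≤ M := fun i j w => by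
    rw [hM]
    have h := Finset.le_sup (f := fun p : (Fin N × Fin N) × InfinitePlace L =>
      ‖((((g : GL (Fin N) (AdeleRing (𝓞 L) L)) : Matrix (Fin N) (Fin N) (AdeleRing (𝓞 L) L)) p.1.1 p.1.2).1 p.2)‖₊) (Finset.mem_univ ((i, j), w))
    exact h
  -- `M² ≤ h(1,(g_{ij}))` (§1, `L` totally complex)
  have hM2 : M ^ 2 ≤ vecHeight L (fun o : Option (Fin N × Fin N) => o.elim 1 fun ij =>
      ((g : GL (Fin N) (AdeleRing (𝓞 L) L)) : Matrix (Fin N) (Fin N) (AdeleRing (𝓞 L) L)) ij.1 ij.2) := by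
    rw [← NNReal.le_sqrt_iff_sq_le, hM]
    refine Finset.sup_le fun p _ => ?_
    rw [NNReal.le_sqrt_iff_sq_le]
    exact nnnorm_fst_sq_le_vecHeight (x := fun o : Option (Fin N × Fin N) => o.elim 1 fun ij =>
      ((g : GL (Fin N) (AdeleRing (𝓞 L) L)) : Matrix (Fin N) (Fin N) (AdeleRing (𝓞 L) L)) ij.1 ij.2) none rfl (some p.1) p.2
  -- every entry of `g_∞` and `g_∞⁻¹` is `≤ (1 ⊔ C_d) · M`
  have harch : GLn.archHeight N L (g : GL (Fin N) (AdeleRing (𝓞 L) L)) ≤ max 1 Cd * M :=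
    archHeight_le_of_forall_nnnorm_le _ (fun i j w => (hentry i j w).trans (le_mul_of_one_le_left' (le_max_left _ _)))
      fun i k w => by
        rw [nnnorm_inv_entry_fst_apply L dV hdV0 g i k w]
        exact mul_le_mul' (hCd1 i k w) (hentry k i _)
  calc GLn.archHeight N L (g : GL (Fin N) (AdeleRing (𝓞 L) L)) ^ 2 ≤ (max 1 Cd * M) ^ 2 := pow_le_pow_left₀ zero_le harch 2
    _ = max 1 Cd ^ 2 * M ^ 2 := mul_pow _ _ 2
    _ ≤ _ := mul_le_mul' le_rfl hM2

end Unitary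

/-! ## §3 The Plücker height of record decays SHARPLY along `ι(·,1)` in the archimedean height -/

section Doubling

variable (L : Type) [Field L] [NumberField L] [IsCMField L]
variable {N n : ℕ} (e : Fin N × Fin 1 ≃ Fin n)
  (dV : Fin N → L) (hdV : ∀ i, IsCMField.complexConj L (dV i) = dV i)
  (dW : Fin 1 → L) (hdW : ∀ i, IsCMField.complexConj L (dW i) = dW i)

/-- **THE HEIGHT OF RECORD WITH SHARP ARCHIMEDEAN DECAY.**  For non-degenerate data (`N ≥ 1`) the Plücker height of record
`Φ₀(x) = h_L(ξ₀ · x^{(n)})^{-1∕2}` — continuous, positive, of type `(P_Δ, modDelta)` (properties (0)–(2) re-run verbatim from ★ #16a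
`exists_continuous_height_decay`) — satisfies **`Φ₀(ι(g,1)) ≤ C · H_∞(g)^{-1}`** on `U(V)(𝔸)`:
`H_∞(g)² ≤ C₃ h(1,(g_{ij})) ≤ C₃ C₁ h(π(ι(g,1)))` (§2, ★ #16a §3). [cite: GelbartPiatetskishapiroRallis1987, Part A §2]
[cite: Liu2021, Lem. B.10 (2) p. 102] [cite: BorelJacquet1979, §1.2] -/
theorem exists_continuous_height_archDecay [NeZero N] (hdV0 : ∀ i, dV i ≠ 0) (hdW0 : ∀ i, dW i ≠ 0) :
    ∃ Φ₀ : HA L e dV hdV dW hdW → ℝ, Continuous Φ₀ ∧ (∀ x, 0 < Φ₀ x) ∧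
      (∀ p x : HA L e dV hdV dW hdW, IsSiegelDelta L e dV hdV dW hdW p →
        Φ₀ (p * x) = modDelta L e dV hdV dW hdW p * Φ₀ x) ∧
      ∃ C : ℝ, 0 < C ∧ ∀ g : UnitaryGroup.adelic (Fp L) L (IsCMField.complexConj L) N (Matrix.diagonal dV),
        Φ₀ (iotaLeft L e dV hdV dW hdW g) ≤ C * ((GLn.archHeight N L (g : GL (Fin N) (AdeleRing (𝓞 L) L)) : ℝ))⁻¹ := by
  classical
  -- the rational frame row `ξ₀` and the Plücker vector `π(x) = ξ₀ · x^{(n)}` (verbatim from ★ #16a §4)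
  set R₀L : Matrix (Fin n) (Fin (n + n)) L :=
    (Matrix.fromCols (1 : Matrix (Fin n) (Fin n) L) (-(1 : Matrix (Fin n) (Fin n) L)) :
      Matrix (Fin n) (Fin n ⊕ Fin n) L).submatrix id (e₂ (n := n)).symm with hR₀L
  have hcard : (Finset.univ : Finset (Fin n)).card = n := by rw [Finset.card_univ, Fintype.card_fin]
  set I₁ : Set.powersetCard (Fin n) n := Set.powersetCard.ofCard hcard with hI₁
  set ξ₀ : Set.powersetCard (Fin (n + n)) n → L := fun J => compound n R₀L I₁ J with hξ₀
  have hξ₀ne : ξ₀ ≠ 0 := frame_compound_row_ne_zero L I₁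
  set π : HA L e dV hdV dW hdW → Set.powersetCard (Fin (n + n)) n → AdeleRing (𝓞 L) L := fun x =>
    principalVec L ξ₀ ᵥ* compound n ((x : GL (Fin (n + n)) (AdeleRing (𝓞 L) L)) : Matrix (Fin (n + n)) (Fin (n + n)) (AdeleRing (𝓞 L) L))
    with hπ
  have hπrow : ∀ x : HA L e dV hdV dW hdW, (fun J => compound n ((Matrix.fromCols (1 : Matrix (Fin n) (Fin n) (AdeleRing (𝓞 L) L))
      (-(1 : Matrix (Fin n) (Fin n) (AdeleRing (𝓞 L) L))) : Matrix (Fin n) (Fin n ⊕ Fin n) (AdeleRing (𝓞 L) L)).submatrix id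
        (e₂ (n := n)).symm * ((x : GL (Fin (n + n)) (AdeleRing (𝓞 L) L)) : Matrix (Fin (n + n)) (Fin (n + n)) (AdeleRing (𝓞 L) L))) I₁ J) =
      π x := fun x => pluckerVec_eq_principalVec_vecMul L e dV hdV dW hdW x I₁
  -- the height and `Φ₀`
  set H : HA L e dV hdV dW hdW → ℝ≥0 := fun x => vecHeight L (π x) with hH
  have hHpos : ∀ x, 0 < H x := fun x => vecHeight_principalVec_vecMul_compound_pos L hξ₀ne _
  have hHfin : ∀ x, IsHeightFinite L (π x) := fun x => isHeightFinite_principalVec_vecMul_compound L hξ₀ne _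
  have hHcont : Continuous H :=
    (continuous_vecHeight_vecMul_compound L (principalVec L ξ₀)).comp continuous_subtype_val
  refine ⟨fun x => ((H x : ℝ)) ^ (-(1 / 2 : ℝ)), ?_, fun x => Real.rpow_pos_of_pos (NNReal.coe_pos.2 (hHpos x)) _, ?_, ?_⟩
  · -- (0) continuity
    exact (NNReal.continuous_coe.comp hHcont).rpow_const fun x => Or.inl (NNReal.coe_pos.2 (hHpos x)).ne'
  · -- (2) type `(P_Δ, modDelta)` (verbatim from ★ #16a, adapted from ★ p854922)
    intro p x hp
    have hΔ : IsUnit (detDelta L e dV hdV dW hdW p) := isUnit_detDelta_of_isSiegelDelta L e dV hdV dW hdW p hp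
    have hD := isUnit_det_D L e dV hdV dW hdW hp
    -- `π(p x) = det D_p • π(x)`
    have hπp : π (p * x) = ((hD.unit : (AdeleRing (𝓞 L) L)ˣ) : AdeleRing (𝓞 L) L) • π x := by
      rw [← hπrow (p * x), ← hπrow x]
      funext J
      rw [Pi.smul_apply, smul_eq_mul, IsUnit.unit_spec, Subgroup.coe_mul, Units.val_mul, ← Matrix.mul_assoc,
        frame_mul_coe_of_isSiegelDelta L e dV hdV dW hdW hp, Matrix.mul_assoc,
        compound_mul_apply_of_card_eq (card_fin_eq n)]
    have hHp : H (p * x) = IdeleClassGroup.ideleNorm L hD.unit * H x := by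
      rw [hH]; dsimp only; rw [hπp, vecHeight_smul (hHfin x)]
    have hnorm := ideleNorm_detDelta_mul_ideleNorm_det_D L e dV hdV dW hdW hdV0 hdW0 hp hΔ hD
    have hDinv : IdeleClassGroup.ideleNorm L hD.unit = (IdeleClassGroup.ideleNorm L hΔ.unit)⁻¹ :=
      eq_inv_of_mul_eq_one_right hnorm
    have hmod : modDelta L e dV hdV dW hdW p = Real.sqrt (IdeleClassGroup.ideleNorm L hΔ.unit : ℝ) := by
      rw [modDelta, dif_pos hΔ, coe_ideleNorm]
    dsimp only
    rw [hHp, hDinv, NNReal.coe_mul, NNReal.coe_inv, hmod, Real.sqrt_eq_rpow,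
      Real.mul_rpow (inv_nonneg.2 (NNReal.coe_nonneg _)) (NNReal.coe_nonneg _), Real.inv_rpow (NNReal.coe_nonneg _),
      Real.rpow_neg (NNReal.coe_nonneg _), inv_inv]
  · -- SHARP decay along `ι(·,1)` in `H_∞`
    obtain ⟨C₃, hC₃⟩ := exists_archHeight_sq_le_vecHeight_one_entries L dV hdV0
    set C₁ : ℝ≥0 := ∏ w : InfinitePlace L, NNReal.sqrt (Fintype.card (Option (Fin N × Fin N))) ^ w.mult with hC₁
    set c : ℝ := max ((C₃ : ℝ) * C₁) 1 with hc
    have hcpos : 0 < c := lt_of_lt_of_le one_pos (le_max_right _ _)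
    refine ⟨Real.sqrt c, Real.sqrt_pos.2 hcpos, fun g => ?_⟩
    have hapos : 0 < (GLn.archHeight N L (g : GL (Fin N) (AdeleRing (𝓞 L) L)) : ℝ) := NNReal.coe_pos.2 (GLn.archHeight_pos _)
    -- `H_∞(g)² ≤ C₃ h(1,(g_{ij})) ≤ C₃ C₁ H(ι(g,1)) ≤ c · H(ι(g,1))`
    have hx : vecHeight L (fun o : Option (Fin N × Fin N) => o.elim 1 fun ij =>
        ((g : GL (Fin N) (AdeleRing (𝓞 L) L)) : Matrix (Fin N) (Fin N) (AdeleRing (𝓞 L) L)) ij.1 ij.2) ≤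
        C₁ * H (iotaLeft L e dV hdV dW hdW g) := by
      have h := vecHeight_one_entries_le_plucker L e dV hdV dW hdW g I₁
      rw [hπrow] at h
      exact h
    have h2 : GLn.archHeight N L (g : GL (Fin N) (AdeleRing (𝓞 L) L)) ^ 2 ≤ C₃ * C₁ * H (iotaLeft L e dV hdV dW hdW g) :=
      (hC₃ g).trans (by rw [mul_assoc]; exact mul_le_mul' le_rfl hx)
    have h1 : ((GLn.archHeight N L (g : GL (Fin N) (AdeleRing (𝓞 L) L)) : ℝ)) ^ 2 ≤ c * (H (iotaLeft L e dV hdV dW hdW g) : ℝ) := by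
      have h3 : ((GLn.archHeight N L (g : GL (Fin N) (AdeleRing (𝓞 L) L)) : ℝ)) ^ 2 ≤
          (C₃ : ℝ) * (C₁ : ℝ) * (H (iotaLeft L e dV hdV dW hdW g) : ℝ) := by exact_mod_cast h2
      exact h3.trans (mul_le_mul_of_nonneg_right (le_max_left _ _) (NNReal.coe_nonneg _))
    -- `H^{-1/2} ≤ (H_∞²/c)^{-1/2} = √c · H_∞⁻¹`
    have hdiv : ((GLn.archHeight N L (g : GL (Fin N) (AdeleRing (𝓞 L) L)) : ℝ)) ^ 2 / c ≤ (H (iotaLeft L e dV hdV dW hdW g) : ℝ) := by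
      rw [div_le_iff₀ hcpos, mul_comm]; exact h1
    dsimp only
    calc ((H (iotaLeft L e dV hdV dW hdW g) : ℝ)) ^ (-(1 / 2 : ℝ))
        ≤ (((GLn.archHeight N L (g : GL (Fin N) (AdeleRing (𝓞 L) L)) : ℝ)) ^ 2 / c) ^ (-(1 / 2 : ℝ)) :=
          Real.rpow_le_rpow_of_nonpos (div_pos (pow_pos hapos 2) hcpos) hdiv (by norm_num)
      _ = Real.sqrt c * ((GLn.archHeight N L (g : GL (Fin N) (AdeleRing (𝓞 L) L)) : ℝ))⁻¹ := by
          rw [Real.div_rpow (pow_pos hapos 2).le hcpos.le, Real.rpow_neg hcpos.le, Real.rpow_neg (pow_pos hapos 2).le,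
            ← Real.sqrt_eq_rpow, ← Real.sqrt_eq_rpow, Real.sqrt_sq hapos.le, div_inv_eq_mul, mul_comm]

/-! ## §4 Brick B4′: every `P_Δ`-height decays sharply in `H_∞` along `ι(·,1)` -/

/-- **BRICK B4′ — SHARP ARCHIMEDEAN DECAY ALONG THE DOUBLING EMBEDDING.**  For non-degenerate hermitian data over a CM field (`N ≥ 1`) and
every continuous `Φ : H(𝔸) → ℝ` of type `(P_Δ, |det_Δ|^{1∕2})` there is `C > 0` with **`Φ(ι(g,1)) ≤ C · H_∞(g)^{-1}`** for all
`g ∈ U(V)(𝔸)`, `H_∞ = GLn.archHeight` the archimedean height: `Φ ≤ C' Φ₀` for the height of record (★ p854882 over the Iwasawa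
decomposition ★ (I)) and `Φ₀` decays sharply (§3).  The exponent `1` is the one the archimedean slice of #32dR needs (`τ > 2N − 2`).
[cite: GelbartPiatetskishapiroRallis1987, Part A §2] [cite: Liu2021, Lem. B.10 (2) p. 102] [cite: BorelJacquet1979, §1.2 and §4.2] -/
theorem exists_decay_archHeight [NeZero N] (hdV0 : ∀ i, dV i ≠ 0) (hdW0 : ∀ i, dW i ≠ 0)
    (Φ : HA L e dV hdV dW hdW → ℝ) (hΦc : Continuous Φ)
    (hΦ : ∀ p x : HA L e dV hdV dW hdW, IsSiegelDelta L e dV hdV dW hdW p → Φ (p * x) = modDelta L e dV hdV dW hdW p * Φ x) :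
    ∃ C : ℝ, 0 < C ∧ ∀ g : UnitaryGroup.adelic (Fp L) L (IsCMField.complexConj L) N (Matrix.diagonal dV),
      Φ (iotaLeft L e dV hdV dW hdW g) ≤ C * ((GLn.archHeight N L (g : GL (Fin N) (AdeleRing (𝓞 L) L)) : ℝ))⁻¹ := by
  obtain ⟨K, hK, hPK⟩ := K2LiuSiegelDoubledIwasawaCompact.exists_isCompact_isSiegelDelta_mul L e dV hdV dW hdW hdV0 hdW0
  obtain ⟨Φ₀, h0c, h0pos, h0Δ, C₀, hC₀, hdecay⟩ := exists_continuous_height_archDecay L e dV hdV dW hdW hdV0 hdW0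
  obtain ⟨C', hC', hle⟩ :=
    K2LiuDoublingHeightComparison.exists_pos_forall_le_mul L e dV hdV dW hdW hK hPK hΦc h0c h0pos hΦ h0Δ
  refine ⟨C' * C₀, mul_pos hC' hC₀, fun g => ?_⟩
  calc Φ (iotaLeft L e dV hdV dW hdW g) ≤ C' * Φ₀ (iotaLeft L e dV hdV dW hdW g) := hle _
    _ ≤ C' * (C₀ * ((GLn.archHeight N L (g : GL (Fin N) (AdeleRing (𝓞 L) L)) : ℝ))⁻¹) :=
        mul_le_mul_of_nonneg_left (hdecay g) hC'.le
    _ = C' * C₀ * ((GLn.archHeight N L (g : GL (Fin N) (AdeleRing (𝓞 L) L)) : ℝ))⁻¹ := by ring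

/-- **B4′ on a height shell**: with the constant of `exists_decay_archHeight`, `e^k ≤ H_∞(g)` gives `Φ(ι(g,1)) ≤ C · e^{-k}` — the form
brick B1 (★ `K2LiuDoublingHeightShellBound.integrable_of_shellBound`) consumes on the shell `S_k = {e^k ≤ H_∞ < e^{k+1}}`. [cite: BorelJacquet1979, §1.2] -/
theorem decay_on_shell {C : ℝ} (hC : 0 < C) {Φg H : ℝ} (hle : Φg ≤ C * H⁻¹) (k : ℝ) (hk : Real.exp k ≤ H) :
    Φg ≤ C * Real.exp (-k) := by
  refine hle.trans (mul_le_mul_of_nonneg_left ?_ hC.le)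
  rw [Real.exp_neg]
  exact inv_anti₀ (Real.exp_pos k) hk

end Doubling

end Summit.HodgeConjecture.HodgeConjecture.Cruxes.HLiu418.K2LiuDoublingHeightArchDecay

end
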